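import Mathlib
import HarnessLib

/-!
# The constant of [ABKM19] (7.74): the derivative bound of the finite-range decomposition in the
# coefficient matrix is at most `K₁ L^{4(d+ñ)+2}` times its lower shell bound

Clause (v) of `GradientFRD.TorusFRD` (Buchholz 2018, Thm 2.4) gives, for a momentum `κ` in the
dyadic shell `j` and the kernel of scale `k`, the LOWER bound
`c L^{−(2(d+ñ)+1)} L^{2j} L^{−(k−j)(d−1+n)} ≤ Re 𝒞̂_{A,k}(κ)` (`j < k`), resp.
`c L^{−(2(d+ñ)+1)} L^{2k} ≤ Re 𝒞̂_{A,k}(κ)` (`k ≤ j`), and for the derivative in a unit symmetric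
direction the UPPER bound `C₁ L^{2(d+ñ)+1} L^{2j} L^{−(k−j)(d−1+ñ)}` (`j < k`), resp. `C₁ L^{2k}`
(`k ≤ j`).  [ABKM19] (7.74) divides the two: `|∂_t 𝒞̂^{(tq)}_{k+1}(p)| ≤ |q| K₁ L^{4(d+ñ)+2} 𝒞̂^{(0)}_{k+1}(p)`.
This file is that division, as pure arithmetic of the shell factors (`L ≥ 1`, `n ≤ ñ`, `c > 0`):

* `shellRatioConst c C₁ L d ñ = (C₁/c) · L^{4(d+ñ)+2}`;
* **`deriv_shell_bound_le_ratio_mul_lower_lt`** (`j < k`) and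
  **`deriv_shell_bound_le_ratio_mul_lower_le`** (`k ≤ j`): `upper ≤ shellRatioConst · lower`;
* `abs_deriv_le_ratio_mul_of_shell_bounds` — the packaged form `|c'| ≤ K · Re ĉ` from the two clause-(v)
  inequalities, ready for `CovarianceComparisonGronwall.le_one_add_mul_of_abs_deriv_le`.

Everything is proved; no named fact.

## References
* S. Adams, S. Buchholz, R. Kotecký, S. Müller, arXiv:1910.13564, Lemma 7.7 (7.74) [AdamsBuchholzKoteckyMuller2019].
* S. Buchholz, J. Funct. Anal. 275 (2018), Thm 2.4 [Buchholz2016].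
-/

noncomputable section

namespace Literature.MathematicalPhysics.StatisticalMechanics.GradientRG

/-- **`K₁ L^{4(d+ñ)+2}`** with `K₁ = C₁/c`: the ratio of the derivative shell bound to the lower shell
bound of the finite-range decomposition. [cite: AdamsBuchholzKoteckyMuller2019, Lemma 7.7 (7.74)] -/
def shellRatioConst (c C₁ L : ℝ) (d ñ : ℕ) : ℝ := C₁ / c * L ^ (4 * (d + ñ) + 2)

/-- `shellRatioConst ≥ 0` for `c > 0`, `C₁, L ≥ 0`. [cite: AdamsBuchholzKoteckyMuller2019, Lemma 7.7 (7.74)] -/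
theorem shellRatioConst_nonneg {c C₁ L : ℝ} (hc : 0 < c) (hC₁ : 0 ≤ C₁) (hL : 0 ≤ L) (d ñ : ℕ) :
    0 ≤ shellRatioConst c C₁ L d ñ := by
  unfold shellRatioConst; positivity

/-- **The shells `j < k`**: `C₁ L^{2(d+ñ)+1} L^{2j} / L^{(k−j)(d−1+ñ)} ≤ K · (c/L^{2(d+ñ)+1} · L^{2j} / L^{(k−j)(d−1+n)})`
with `K = shellRatioConst c C₁ L d ñ`, for `L ≥ 1`, `n ≤ ñ`, `c > 0`, `C₁ ≥ 0`.
[cite: AdamsBuchholzKoteckyMuller2019, Lemma 7.7 (7.74)] -/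
theorem deriv_shell_bound_le_ratio_mul_lower_lt {c C₁ L : ℝ} {d n ñ j k : ℕ} (hc : 0 < c) (hC₁ : 0 ≤ C₁)
    (hL : 1 ≤ L) (hn : n ≤ ñ) :
    C₁ * L ^ (2 * (d + ñ) + 1) * L ^ (2 * j) / L ^ ((k - j) * (d - 1 + ñ)) ≤
      shellRatioConst c C₁ L d ñ * (c / L ^ (2 * (d + ñ) + 1) * L ^ (2 * j) / L ^ ((k - j) * (d - 1 + n))) := by
  have hL0 : 0 < L := by linarith
  unfold shellRatioConst
  -- compare the two negative powers: `L^{(k-j)(d-1+n)} ≤ L^{(k-j)(d-1+ñ)}`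
  have hpow : L ^ ((k - j) * (d - 1 + n)) ≤ L ^ ((k - j) * (d - 1 + ñ)) :=
    pow_le_pow_right₀ hL (Nat.mul_le_mul_left _ (by omega))
  have hA : 0 < L ^ ((k - j) * (d - 1 + n)) := pow_pos hL0 _
  have hB : 0 < L ^ ((k - j) * (d - 1 + ñ)) := pow_pos hL0 _
  have hE : 0 < L ^ (2 * (d + ñ) + 1) := pow_pos hL0 _
  -- rewrite the right-hand side as `C₁ L^{2(d+ñ)+1} L^{2j} / L^{(k-j)(d-1+n)}` using `L^{4(d+ñ)+2} = (L^{2(d+ñ)+1})²`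
  have hsq : L ^ (4 * (d + ñ) + 2) = L ^ (2 * (d + ñ) + 1) * L ^ (2 * (d + ñ) + 1) := by
    rw [← pow_add]; congr 1; ring
  have hrhs : C₁ / c * L ^ (4 * (d + ñ) + 2) * (c / L ^ (2 * (d + ñ) + 1) * L ^ (2 * j) / L ^ ((k - j) * (d - 1 + n))) =
      C₁ * L ^ (2 * (d + ñ) + 1) * L ^ (2 * j) / L ^ ((k - j) * (d - 1 + n)) := by
    rw [hsq]; field_simp
  rw [hrhs]
  exact div_le_div_of_nonneg_left (by positivity) hA hpow

/-- **The shells `k ≤ j`**: `C₁ L^{2k} ≤ K · (c/L^{2(d+ñ)+1} · L^{2k})` with `K = shellRatioConst c C₁ L d ñ`,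
for `L ≥ 1`, `c > 0`, `C₁ ≥ 0`. [cite: AdamsBuchholzKoteckyMuller2019, Lemma 7.7 (7.74)] -/
theorem deriv_shell_bound_le_ratio_mul_lower_le {c C₁ L : ℝ} {d ñ k : ℕ} (hc : 0 < c) (hC₁ : 0 ≤ C₁)
    (hL : 1 ≤ L) :
    C₁ * L ^ (2 * k) ≤ shellRatioConst c C₁ L d ñ * (c / L ^ (2 * (d + ñ) + 1) * L ^ (2 * k)) := by
  have hL0 : 0 < L := by linarith
  unfold shellRatioConst
  have hE : 0 < L ^ (2 * (d + ñ) + 1) := pow_pos hL0 _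
  have hsq : L ^ (4 * (d + ñ) + 2) = L ^ (2 * (d + ñ) + 1) * L ^ (2 * (d + ñ) + 1) := by
    rw [← pow_add]; congr 1; ring
  have hrhs : C₁ / c * L ^ (4 * (d + ñ) + 2) * (c / L ^ (2 * (d + ñ) + 1) * L ^ (2 * k)) =
      C₁ * L ^ (2 * k) * L ^ (2 * (d + ñ) + 1) := by
    rw [hsq]; field_simp
  rw [hrhs]
  have h1 : 1 ≤ L ^ (2 * (d + ñ) + 1) := one_le_pow₀ hL
  have h0 : 0 ≤ C₁ * L ^ (2 * k) := by positivity
  nlinarith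

/-- **`|c'| ≤ K · Re ĉ` from the two clause-(v) inequalities** (either shell case): if
`lower ≤ Re ĉ`, `|c'| ≤ upper` and `upper ≤ K · lower` with `K ≥ 0`, then `|c'| ≤ K · Re ĉ`.
[cite: AdamsBuchholzKoteckyMuller2019, Lemma 7.7 (7.74)] -/
theorem abs_deriv_le_ratio_mul_of_shell_bounds {c' re lower upper K : ℝ} (hK : 0 ≤ K)
    (hlow : lower ≤ re) (hup : |c'| ≤ upper) (hratio : upper ≤ K * lower) : |c'| ≤ K * re :=
  hup.trans (hratio.trans (mul_le_mul_of_nonneg_left hlow hK))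

end Literature.MathematicalPhysics.StatisticalMechanics.GradientRG

end
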